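import Summits.CriticalPhenomena.PercolationContinuityZ3.Theorems.SoloBlindPeriodicFinChains
import HarnessLib

/-!
# A plane wall with a periodic line of pores, I: the chain structure

Seat `solo-CriticalPhenomena-blind`, toward `PercolationContinuityZ3`.  The SLIT regions
`R_Z = ℍ ∪ L_Z`, `ℍ = {0 ≤ x₀}`, `L_Z = {x₀ ≤ -2} ∪ {(-1, 0, z) : z ∈ Z}`: the two half-spaces on
either side of the wall `{x₀ = -1}`, joined through the pore sites `(-1,0,z)`, `z ∈ Z`, of one LINE of
the wall.  This is the chain structure of `SoloBlindPeriodicFinChains` with the planar fin replaced by the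
lower half-space-with-studs `L_Z`; everything that does not look inside the lower side is reused
(`hsp`, `cpt`, `crossE`, `mkChain`, `admSet`).  Pieces (clusters of `K₀ = ℤ³[ℍ] ⊔ ℤ³[L_Z]`) are a.s.
finite at `p_c` by BGN in `{0 ≤ x₀}` and in `{x₀ ≤ -1} ⊇ L_Z`; interface edges are the connector edges
`((0,0,z), (-1,0,z))`, `z ∈ Z`; hence (`exists_adm_mem_disjointOccurrenceList_slit`) an infinite
cluster forces admissible alternating connector chains of every length occurring disjointly.
Note `R_Z ⊇ S_Z` (the periodic fin region): the slit rungs lie ABOVE the fin rungs.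
-/

noncomputable section

namespace Summit.CriticalPhenomena.PercolationContinuityZ3.Theorems

open MeasureTheory Literature.Probability.Percolation Literature.Probability.LatticeModels

/-! ### Geometry of `R_Z` -/

/-- The lower side with pores `Z`: `L_Z = {x₀ ≤ -2} ∪ {(-1, 0, z) : z ∈ Z}`. -/
def slitZ (Z : Set ℤ) : Set (Site 3) :=
  {x : Site 3 | x 0 ≤ -2 ∨ (x 0 = -1 ∧ x 1 = 0 ∧ x 2 ∈ Z)}

/-- The two sides: `true ↦ ℍ`, `false ↦ L_Z`. -/
def sideL (Z : Set ℤ) : Bool → Set (Site 3)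
  | true => hsp
  | false => slitZ Z

/-- The step graph of the region `R_Z = ℍ ∪ L_Z`. -/
def KL (Z : Set ℤ) : SimpleGraph (Site 3) := withinGraph (zdGraph 3) (hsp ∪ slitZ Z)

/-- The step graph without interface edges. -/
def KL0 (Z : Set ℤ) : SimpleGraph (Site 3) :=
  withinGraph (zdGraph 3) hsp ⊔ withinGraph (zdGraph 3) (slitZ Z)

/-- The half-space and the lower side are disjoint. -/
theorem disjoint_hsp_slitZ (Z : Set ℤ) : Disjoint hsp (slitZ Z) := by
  rw [Set.disjoint_left]
  rintro v (hv : 0 ≤ v 0) (h | ⟨h, _, _⟩) <;> omega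

/-- The lower side lies in the half-space `{x₀ ≤ -1}`. -/
theorem slitZ_subset (Z : Set ℤ) : slitZ Z ⊆ {x : Site 3 | x 0 ≤ -1} := by
  rintro v (h | ⟨h, _, _⟩) <;> simp only [Set.mem_setOf_eq] <;> omega

/-- The periodic fin region lies inside the slit region: `F_Z ⊆ L_Z`. -/
theorem finZ_subset_slitZ (Z : Set ℤ) : finZ Z ⊆ slitZ Z := by
  rintro v (⟨_, h⟩ | ⟨h1, h0, hz⟩)
  · exact Or.inl h
  · exact Or.inr ⟨h0, h1, hz⟩

/-- The piece graph is a subgraph of the step graph. -/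
theorem KL0_le_KL (Z : Set ℤ) : KL0 Z ≤ KL Z :=
  sup_le (withinGraph_mono _ Set.subset_union_left) (withinGraph_mono _ Set.subset_union_right)

/-- The step graph is a subgraph of `ℤ³`. -/
theorem KL_le (Z : Set ℤ) : KL Z ≤ zdGraph 3 := withinGraph_le _ _

/-- A connector endpoint lies on its side (for admissible heights). -/
theorem cpt_mem_sideL {Z : Set ℤ} (s : Bool) {z : ℤ} (hz : z ∈ Z) : cpt s z ∈ sideL Z s := by
  cases s
  · right
    refine ⟨by simp [cpt], by simp [cpt], ?_⟩
    simpa [cpt] using hz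
  · exact cpt_true_mem_hsp z

/-- Each side lies in the region. -/
theorem sideL_subset_union (Z : Set ℤ) (s : Bool) : sideL Z s ⊆ hsp ∪ slitZ Z := by
  cases s
  · exact Set.subset_union_right
  · exact Set.subset_union_left

/-- `KL` is locally finite. -/
theorem KL_neighborSet_finite (Z : Set ℤ) (u : Site 3) : ((KL Z).neighborSet u).Finite := by
  refine ((zdGraph 3).neighborFinset u).finite_toSet.subset fun v hv => ?_
  rw [SimpleGraph.mem_neighborSet] at hv
  simpa using KL_le Z hv

/-! ### Pieces are one-sided -/

/-- An edge of the piece graph from a half-space vertex is a half-space edge. -/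
theorem KL0_adj_of_mem_hsp {Z : Set ℤ} {u w : Site 3} (hu : u ∈ hsp) (h : (KL0 Z).Adj u w) :
    (withinGraph (zdGraph 3) hsp).Adj u w := by
  rcases h with h | h
  · exact h
  · exact absurd hu (Set.disjoint_right.1 (disjoint_hsp_slitZ Z) h.2.1)

/-- An edge of the piece graph from a lower vertex is a lower edge. -/
theorem KL0_adj_of_mem_slitZ {Z : Set ℤ} {u w : Site 3} (hu : u ∈ slitZ Z) (h : (KL0 Z).Adj u w) :
    (withinGraph (zdGraph 3) (slitZ Z)).Adj u w := by
  rcases h with h | h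
  · exact absurd hu (Set.disjoint_left.1 (disjoint_hsp_slitZ Z) h.2.1)
  · exact h

/-- The piece of a vertex of `ℍ` is contained in its `ℍ`-cluster. -/
theorem pieceL_subset_of_mem_hsp {Z : Set ℤ} {ω : BondConfig (Site 3)} {v : Site 3} (hv : v ∈ hsp) :
    openClusterIn (KL0 Z) ω v ⊆ openClusterIn (withinGraph (zdGraph 3) hsp) ω v := by
  intro z hz
  rw [mem_openClusterIn_iff] at hz ⊢
  refine (reachable_of_closed (G := openGraph ω ⊓ KL0 Z) (A := hsp) ?_ hv hz).1
  intro u w hu hadj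
  rw [SimpleGraph.inf_adj] at hadj
  have h' := KL0_adj_of_mem_hsp hu hadj.2
  exact ⟨(SimpleGraph.inf_adj _ _ _ _).2 ⟨hadj.1, h'⟩, h'.2.2⟩

/-- The piece of a lower vertex is contained in its lower cluster. -/
theorem pieceL_subset_of_mem_slitZ {Z : Set ℤ} {ω : BondConfig (Site 3)} {v : Site 3}
    (hv : v ∈ slitZ Z) :
    openClusterIn (KL0 Z) ω v ⊆ openClusterIn (withinGraph (zdGraph 3) (slitZ Z)) ω v := by
  intro z hz
  rw [mem_openClusterIn_iff] at hz ⊢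
  refine (reachable_of_closed (G := openGraph ω ⊓ KL0 Z) (A := slitZ Z) ?_ hv hz).1
  intro u w hu hadj
  rw [SimpleGraph.inf_adj] at hadj
  have h' := KL0_adj_of_mem_slitZ hu hadj.2
  exact ⟨(SimpleGraph.inf_adj _ _ _ _).2 ⟨hadj.1, h'⟩, h'.2.2⟩

/-- Pieces stay on their side. -/
theorem pieceL_subset_sideL {Z : Set ℤ} {ω : BondConfig (Site 3)} (s : Bool) {v : Site 3}
    (hv : v ∈ sideL Z s) : openClusterIn (KL0 Z) ω v ⊆ sideL Z s := by
  cases s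
  · exact (pieceL_subset_of_mem_slitZ hv).trans (openClusterIn_withinGraph_subset hv _)
  · exact (pieceL_subset_of_mem_hsp hv).trans (openClusterIn_withinGraph_subset hv _)

/-- The piece of a vertex outside `R_Z` is a singleton. -/
theorem pieceL_eq_singleton_of_not_mem {Z : Set ℤ} {ω : BondConfig (Site 3)} {v : Site 3}
    (hv : v ∉ hsp ∪ slitZ Z) : openClusterIn (KL0 Z) ω v = {v} := by
  refine Set.Subset.antisymm (fun z hz => ?_) ?_
  · rw [mem_openClusterIn_iff] at hz
    have := (reachable_of_closed (G := openGraph ω ⊓ KL0 Z) (H := ⊥) (A := (hsp ∪ slitZ Z)ᶜ) ?_ hv hz).1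
    · exact (SimpleGraph.reachable_bot.1 this).symm
    · intro u w hu hadj
      rw [SimpleGraph.inf_adj] at hadj
      rcases hadj.2 with h | h
      · exact absurd (Or.inl h.2.1) hu
      · exact absurd (Or.inr h.2.1) hu
  · rintro z rfl; exact self_mem_openClusterIn _ _ _

/-- **All pieces are finite, a.s.** (BGN in the half-spaces `{0 ≤ x₀}` and `{x₀ ≤ -1}`). -/
theorem ae_forall_pieceL_finite (Z : Set ℤ) :
    ∀ᵐ ω ∂(bondPercolation (zdGraph 3) (criticalProbI 3)), ∀ v, (openClusterIn (KL0 Z) ω v).Finite := by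
  filter_upwards [RegionGluing.ae_forall_not_percolatesVia_coordHalfSpace] with ω hH v
  by_cases hv : v ∈ hsp ∪ slitZ Z
  · rcases hv with hv | hv
    · exact (Set.not_infinite.1 (hH 0 0 v).1).subset (pieceL_subset_of_mem_hsp hv)
    · refine (Set.not_infinite.1 (hH 0 (-1) v).2).subset ((pieceL_subset_of_mem_slitZ hv).trans ?_)
      exact openClusterIn_mono_graph (withinGraph_mono _ (slitZ_subset Z)) ω v
  · rw [pieceL_eq_singleton_of_not_mem hv]; exact Set.finite_singleton v

/-! ### Interface edges are connector edges -/

/-- The cross edges of `R_Z` are exactly `((0,0,z), (-1,0,z))`, `z ∈ Z`. -/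
theorem slit_crossEdge_eq {Z : Set ℤ} {e : Site 3 × Site 3}
    (he : e.1 ∈ hsp ∧ e.2 ∈ slitZ Z ∧ (zdGraph 3).Adj e.1 e.2) :
    e.2 2 ∈ Z ∧ e.1 = cpt true (e.2 2) ∧ e.2 = cpt false (e.2 2) := by
  obtain ⟨h1, h2, hadj⟩ := he
  have h1' : 0 ≤ e.1 0 := h1
  have hle : e.2 0 ≤ -1 := slitZ_subset Z h2
  have hmate := eq_add_single_of_zdGraph_adj_of_nonneg_of_le h1' hle hadj
  have h0 : e.1 0 = e.2 0 + 1 := by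
    have := congrArg (fun f : Site 3 => f 0) hmate
    simpa using this
  have hcoord : ∀ i, i ≠ (0 : Fin 3) → e.1 i = e.2 i := by
    intro i hi
    have := congrArg (fun f : Site 3 => f i) hmate
    simpa [Pi.single_eq_of_ne hi] using this
  rcases h2 with h | ⟨h20, h21, h2Z⟩
  · exfalso; omega
  have hA : e.1 = cpt true (e.2 2) := by
    funext i
    match i with
    | 0 => simp only [cpt]; rw [Function.update_of_ne (by decide), Pi.zero_apply]; omega
    | 1 => simp only [cpt]; rw [Function.update_of_ne (by decide), Pi.zero_apply, hcoord 1 (by decide)]; exact h21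
    | 2 => simp only [cpt]; rw [Function.update_self, hcoord 2 (by decide)]
  refine ⟨h2Z, hA, ?_⟩
  have : cpt false (e.2 2) = cpt true (e.2 2) - Pi.single 0 1 := rfl
  rw [this, ← hA, hmate, add_sub_cancel_right]

/-- An interface edge leaving side `s` is the connector edge `crossE s z` of some `z ∈ Z`. -/
theorem eq_crossE_of_adj_slit {Z : Set ℤ} {e : Site 3 × Site 3} (s : Bool) (h1 : e.1 ∈ sideL Z s)
    (hK : (KL Z).Adj e.1 e.2) (hK0 : ¬(KL0 Z).Adj e.1 e.2) :
    ∃ z ∈ Z, e = crossE s z := by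
  obtain ⟨hadj, hu, hw⟩ := hK
  have hK0' : ¬(e.1 ∈ hsp ∧ e.2 ∈ hsp) ∧ ¬(e.1 ∈ slitZ Z ∧ e.2 ∈ slitZ Z) := by
    constructor
    · exact fun h => hK0 (Or.inl ⟨hadj, h.1, h.2⟩)
    · exact fun h => hK0 (Or.inr ⟨hadj, h.1, h.2⟩)
  cases s
  · have h1' : e.1 ∈ slitZ Z := h1
    have h2 : e.2 ∈ hsp := by
      rcases hw with hw | hw
      · exact hw
      · exact absurd ⟨h1', hw⟩ hK0'.2
    obtain ⟨hz, hA, hB⟩ := slit_crossEdge_eq (Z := Z) (e := (e.2, e.1)) ⟨h2, h1', hadj.symm⟩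
    exact ⟨e.1 2, hz, Prod.ext hB hA⟩
  · have h1' : e.1 ∈ hsp := h1
    have h2 : e.2 ∈ slitZ Z := by
      rcases hw with hw | hw
      · exact absurd ⟨h1', hw⟩ hK0'.1
      · exact hw
    obtain ⟨hz, hA, hB⟩ := slit_crossEdge_eq (Z := Z) (e := e) ⟨h1', h2, hadj⟩
    exact ⟨e.2 2, hz, Prod.ext hA hB⟩

/-! ### Exact chains in `R_Z` are alternating connector chains -/

/-- **Structure of exact chains in `R_Z`.** -/
theorem exactChain_eq_mkChain_slit {Z : Set ℤ} {ω : BondConfig (Site 3)} {x : Site 3} :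
    ∀ (l : List (Site 3 × Site 3)) {k : ℕ} {a y : Site 3} (s : Bool), a ∈ sideL Z s →
    a ∈ depthLayer (KL0 Z) (KL Z) ω x k → ω ∈ exactChain (KL0 Z) (KL Z) x k a l y →
    ∃ f : Fin l.length → ℤ, (∀ i, f i ∈ Z) ∧ l = mkChain l.length s f
  | [], k, a, y, s, _, _, _ => ⟨Fin.elim0, fun i => i.elim0, rfl⟩
  | e :: l, k, a, y, s, ha, hak, hc => by
    obtain ⟨h1, ⟨hK, hω⟩, h3, h4⟩ := mem_exactChain_cons.1 hc
    have hK0 : ¬(KL0 Z).Adj e.1 e.2 := not_adj_of_exactChain hak hc e (by simp)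
    obtain ⟨z, hz, rfl⟩ := eq_crossE_of_adj_slit s (pieceL_subset_sideL s ha h1) hK hK0
    have h2side : (crossE s z).2 ∈ sideL Z (!s) := by
      rw [crossE_snd]; exact cpt_mem_sideL (!s) hz
    obtain ⟨f, hfZ, hl⟩ := exactChain_eq_mkChain_slit l (!s) h2side h3 h4
    refine ⟨Fin.cons z f, fun i => Fin.cases hz hfZ i, ?_⟩
    simp only [List.length_cons, mkChain_succ, Fin.cons_zero, Fin.tail_cons]
    rw [← hl]

/-- **Infinite clusters in `R_Z` force admissible alternating chains of every length.** -/
theorem exists_adm_mem_disjointOccurrenceList_slit {Z : Set ℤ} {ω : BondConfig (Site 3)} {x : Site 3}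
    (s : Bool) (hx : x ∈ sideL Z s) (hfin : ∀ v, (openClusterIn (KL0 Z) ω v).Finite)
    (hperc : ω ∈ percolatesVia (KL Z) x) (n : ℕ) :
    ∃ f : Fin n → ℤ, f ∈ admSet₀ Z n ∧
      ω ∈ disjointOccurrenceList (chainEvents (KL0 Z) x (mkChain n s f)) := by
  obtain ⟨l, y, hl, hc, hD⟩ :=
    exists_exactChain_mem_disjointOccurrenceList hfin (KL_neighborSet_finite Z) hperc n
  subst hl
  obtain ⟨f, hfZ, hlf⟩ := exactChain_eq_mkChain_slit l s hx mem_depthLayer_zero hc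
  have hch := exactChain_isChain_ne mem_depthLayer_zero hc
  rw [hlf] at hch hD
  exact ⟨f, mem_admSet₀_of_isChain _ s f hfZ (by simpa using hch), by simpa using hD⟩

end Summit.CriticalPhenomena.PercolationContinuityZ3.Theorems

end
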